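import Literature.Geometry.Symplectic.SteinBall
import Literature.Geometry.Symplectic.SteinSublevelOfConvex
import Literature.Geometry.Symplectic.SteinOneHandlebodies
import HarnessLib

/-!
# Compact regular strongly `J₀`-convex domains of the ball `B⁴ ⊂ ℂ²` are Stein domains

Topic `Literature/Geometry/Symplectic`; proofs file of the fact seat of
`Literature.Geometry.Symplectic.Gompf1998_thm13_twoHandles` (**E2**, `SteinTwoHandles.lean`).
Cieliebak–Eliashberg 2012, Ch. 2 (the basic examples of Stein domains: regular sublevel sets of
strictly plurisubharmonic functions on `ℂⁿ`; Grauert 1958): for a smooth `Ψ : ℝ⁴ = ℂ² → ℝ`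
whose sublevel set `{Ψ ≤ c}` meets the closed unit ball inside the open ball, with `c` a
regular value and `Ψ` strictly `J₀`-plurisubharmonic on `{Ψ ≤ c}` (flat Levi form
`D²Ψ(u,u) + D²Ψ(J₀u,J₀u) > 0`), the domain `{x ∈ B⁴ : Ψ x ≤ c}` with the restrictions of the
standard structure `(J₀, ·)` of `B⁴` (`SteinBall.lean`) and of `Ψ` is a Stein domain in the
tree's sense (`isSteinDomain_ballSublevel`, via `SteinStructure.sublevelOf` of
`SteinSublevelOfConvex.lean`).

The new ingredient (§1) is the **dictionary between the tree's manifold Levi form on `B⁴` and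
the flat one** for an arbitrary smooth ambient function, generalising `SteinBall.lean`'s
computation for `|z|²`: `d^ℂ(Ψ∘ι) = ι^*(dΨ ∘ J₀)` (`dComplex_ballJ_comp_apply`), hence by
naturality of `d` within the half-space (Mathlib's `extDerivWithin_pullback`)
`dd^ℂ(Ψ∘ι)_x = d(dΨ∘J₀)(x) ∘ (Dι_x × Dι_x)` (`mextDeriv_dComplex_ballJ_comp`) and
`-dd^ℂ(Ψ∘ι)_x(v, J v) = D²Ψ_x(u,u) + D²Ψ_x(J₀u,J₀u)`, `u = Dι_x v`
(`neg_mextDeriv_dComplex_ballJ_comp`).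

Everything is **proved**; no definition, no named fact.

## References

* K. Cieliebak, Ya. Eliashberg, *From Stein to Weinstein and Back*, AMS Colloquium Publ. 59
  (2012), Def. 1.1 ff., Ch. 2. [CieliebakEliashberg2012]
* H. Grauert, *On Levi's problem and the imbedding of real-analytic manifolds*, Ann. of Math.
  68 (1958), 460–472. [folklore]
-/

noncomputable section

open scoped Manifold ContDiff Topology RealInnerProductSpace
open Set Function Metric VectorField

namespace Literature.Geometry.Symplectic

open Literature.Topology.FourManifolds

/-- The model vector space `ℝ⁴`. -/
local notation "E4" => EuclideanSpace ℝ (Fin 4)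

/-- Local notation: the closed unit 4-ball. -/
local notation "𝔻⁴" => (Metric.closedBall (0 : EuclideanSpace ℝ (Fin 4)) 1)

attribute [local instance] fact_finrank_euclideanSpace_succ

variable {Ψ : E4 → ℝ}

/-! ### §1 The Levi form of an ambient function on the ball -/

/-- **The differential of `Ψ ∘ ι`**: `d(Ψ∘ι)_x v = dΨ_x (Dι_x v)`. [folklore] -/
theorem mfderiv_comp_coe_ball_apply (hΨ : Differentiable ℝ Ψ) (x : 𝔻⁴) (v : E4) :
    mfderiv (𝓡∂ 4) 𝓘(ℝ, ℝ) (fun y : 𝔻⁴ => Ψ y) x v = fderiv ℝ Ψ (x : E4) (closedBallCoeDeriv x v) := by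
  rw [mfderiv_comp_coe_closedBall (g := Ψ) x (hΨ _)]
  rfl

/-- **`d^ℂ(Ψ ∘ ι) = ι^* (dΨ ∘ J₀)`**: `(d(Ψ∘ι)_z ∘ J_z)(v) = dΨ_z (J₀ (Dι_z v))`. [folklore] -/
theorem dComplex_ballJ_comp_apply (hΨ : Differentiable ℝ Ψ) (z : 𝔻⁴) (v : Fin 1 → E4) :
    dComplex ballJ (fun y : 𝔻⁴ => Ψ y) z v =
      dComplexFlat stdComplexStructure Ψ (z : E4) (fun i => closedBallCoeDeriv z (v i)) := by
  rw [dComplex_apply, mfderiv_comp_coe_ball_apply hΨ, closedBallCoeDeriv_ballJ, dComplexFlat_apply]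

/-- **The chart representative of `d^ℂ(Ψ∘ι)` at `x` is the pull-back of `dΨ ∘ J₀` along the
inverse ambient chart** (on the chart target). [folklore] -/
theorem inChart_dComplex_ballJ_comp (hΨ : Differentiable ℝ Ψ) (x : 𝔻⁴) {e : E4}
    (he : e ∈ (extChartAt (𝓡∂ 4) x).target) :
    (dComplex ballJ (fun y : 𝔻⁴ => Ψ y)).inChart x e =
      (dComplexFlat stdComplexStructure Ψ ((closedBallAmbChart x).symm e)).compContinuousLinearMap
        (fderiv ℝ (closedBallAmbChart x).symm e) := by
  ext v
  rw [Kaehler.MForm.inChart_apply, dComplex_ballJ_comp_apply hΨ,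
    ContinuousAlternatingMap.compContinuousLinearMap_apply, coe_extChartAt_closedBall_symm_apply x he]
  congr 1
  funext i
  have h := closedBallCoeDeriv_comp_mfderivWithin_extChartAt_symm x he
  exact (congrArg (fun L : E4 →L[ℝ] E4 => L (v i)) h :)

/-- **The manifold exterior derivative of `d^ℂ(Ψ∘ι)` at `x` is the pull-back of the flat one**:
`dd^ℂ(Ψ∘ι)_x = d(dΨ∘J₀)(x) ∘ (Dι_x × Dι_x)` (naturality of `d`, `extDerivWithin_pullback`, in the
chart at `x` within the half-space). [folklore] -/
theorem mextDeriv_dComplex_ballJ_comp (hΨ : ContDiff ℝ ∞ Ψ) (x : 𝔻⁴) :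
    Kaehler.mextDeriv (dComplex ballJ (fun y : 𝔻⁴ => Ψ y)) x =
      (extDeriv (dComplexFlat stdComplexStructure Ψ) (x : E4)).compContinuousLinearMap
        (closedBallCoeDeriv x : E4 →L[ℝ] E4) := by
  have hΨd : Differentiable ℝ Ψ := hΨ.differentiable (by simp)
  set f : E4 → E4 := ⇑(closedBallAmbChart x).symm with hf
  set e₀ : E4 := extChartAt (𝓡∂ 4) x x with he₀
  have he₀t : e₀ ∈ (extChartAt (𝓡∂ 4) x).target := mem_extChartAt_target x
  have he₀r : e₀ ∈ range (𝓡∂ 4) := extChartAt_target_subset_range x he₀t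
  have hU : UniqueDiffOn ℝ (range (𝓡∂ 4)) := (𝓡∂ 4).uniqueDiffOn
  have hfd : ∀ e, DifferentiableAt ℝ f e := fun e =>
    ((contDiff_closedBallAmbChart_symm x).differentiable (by simp)) e
  have heq : (dComplex ballJ (fun y : 𝔻⁴ => Ψ y)).inChart x =ᶠ[𝓝[range (𝓡∂ 4)] e₀]
      fun e => (dComplexFlat stdComplexStructure Ψ (f e)).compContinuousLinearMap
        (fderivWithin ℝ f (range (𝓡∂ 4)) e) := by
    filter_upwards [extChartAt_target_mem_nhdsWithin x] with e he
    rw [inChart_dComplex_ballJ_comp hΨd x he,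
      fderivWithin_eq_fderiv (hU e (extChartAt_target_subset_range x he)) (hfd e)]
  have hpt : (dComplex ballJ (fun y : 𝔻⁴ => Ψ y)).inChart x e₀ =
      (dComplexFlat stdComplexStructure Ψ (f e₀)).compContinuousLinearMap
        (fderivWithin ℝ f (range (𝓡∂ 4)) e₀) := by
    rw [inChart_dComplex_ballJ_comp hΨd x he₀t, fderivWithin_eq_fderiv (hU e₀ he₀r) (hfd e₀)]
  have hpull := extDerivWithin_pullback (r := ∞)
    (differentiable_dComplexFlat stdComplexStructure hΨ (f e₀)).differentiableWithinAt
    ((contDiff_closedBallAmbChart_symm x).contDiffAt.contDiffWithinAt (s := range (𝓡∂ 4)) (x := e₀))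
    (by rw [minSmoothness_of_isRCLikeNormedField]; exact ENat.LEInfty.out) hU
    ((𝓡∂ 4).range_subset_closure_interior he₀r) he₀r (mapsTo_univ f _)
  have hfe₀ : f e₀ = (x : E4) := closedBallAmbChart_symm_extChartAt_self x
  have hDf : fderivWithin ℝ f (range (𝓡∂ 4)) e₀ = (closedBallCoeDeriv x : E4 →L[ℝ] E4) := by
    rw [fderivWithin_eq_fderiv (hU e₀ he₀r) (hfd e₀), coe_closedBallCoeDeriv]
  unfold Kaehler.mextDeriv
  rw [mfderiv_extChartAt_self, Filter.EventuallyEq.extDerivWithin_eq heq hpt, hpull,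
    extDerivWithin_univ, hfe₀, hDf]
  ext v
  rfl

/-- **The Levi form of `Ψ ∘ ι` on `B⁴` is the flat Levi form of `Ψ`**:
`-dd^ℂ(Ψ∘ι)_x(v, J_x v) = D²Ψ_x(u, u) + D²Ψ_x(J₀u, J₀u)` with `u = Dι_x v`.
[cite: CieliebakEliashberg2012, Ch. 2] -/
theorem neg_mextDeriv_dComplex_ballJ_comp (hΨ : ContDiff ℝ ∞ Ψ) (x : 𝔻⁴) (v : E4) :
    -(Kaehler.mextDeriv (dComplex ballJ (fun y : 𝔻⁴ => Ψ y)) x ![v, ballJ x v]) =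
      fderiv ℝ (fderiv ℝ Ψ) (x : E4) (closedBallCoeDeriv x v) (closedBallCoeDeriv x v) +
        fderiv ℝ (fderiv ℝ Ψ) (x : E4) (stdComplexStructure (closedBallCoeDeriv x v))
          (stdComplexStructure (closedBallCoeDeriv x v)) := by
  rw [mextDeriv_dComplex_ballJ_comp hΨ]
  change -(extDeriv (dComplexFlat stdComplexStructure Ψ) (x : E4)
    ((closedBallCoeDeriv x : E4 →L[ℝ] E4) ∘ ![v, ballJ x v])) = _
  have h : ((closedBallCoeDeriv x : E4 →L[ℝ] E4) ∘ ![v, ballJ x v]) =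
      ![closedBallCoeDeriv x v, stdComplexStructure (closedBallCoeDeriv x v)] := by
    funext i
    fin_cases i
    · rfl
    · simp [closedBallCoeDeriv_ballJ]
  rw [h, neg_extDeriv_dComplexFlat_self stdComplexStructure hΨ stdComplexStructure_sq]

/-! ### §2 Strongly `J₀`-convex domains of the ball are Stein domains -/

/-- `Ψ ∘ ι` is smooth on `B⁴`. [folklore] -/
theorem contMDiff_comp_coe_ball (hΨ : ContDiff ℝ ∞ Ψ) :
    ContMDiff (𝓡∂ 4) 𝓘(ℝ, ℝ) ∞ (fun y : 𝔻⁴ => Ψ y) :=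
  hΨ.comp_contMDiff contMDiff_coe_closedBall

/-- A point of `B⁴` with `‖x‖ < 1` is an interior point. [folklore] -/
theorem isInteriorPoint_of_norm_lt_one {x : 𝔻⁴} (hx : ‖(x : E4)‖ < 1) : (𝓡∂ 4).IsInteriorPoint x := by
  by_contra h
  have hb : (𝓡∂ 4).IsBoundaryPoint x := (ModelWithCorners.isInteriorPoint_or_isBoundaryPoint x).resolve_left h
  rw [isBoundaryPoint_iff_norm_eq_one] at hb
  linarith

/-- The interior hypothesis in manifold form. [folklore] -/
theorem ball_hint {c : ℝ} (hin : ∀ x : 𝔻⁴, Ψ x ≤ c → ‖(x : E4)‖ < 1) :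
    ∀ x : 𝔻⁴, (fun y : 𝔻⁴ => Ψ y) x ≤ c → (𝓡∂ 4).IsInteriorPoint x :=
  fun x hx => isInteriorPoint_of_norm_lt_one (hin x hx)

/-- The regularity hypothesis in manifold form: `d(Ψ∘ι)_x = dΨ_x ∘ Dι_x ≠ 0` when `dΨ_x ≠ 0`.
[folklore] -/
theorem ball_hreg (hΨ : ContDiff ℝ ∞ Ψ) {c : ℝ} (hreg : ∀ x : 𝔻⁴, c ≤ Ψ x → fderiv ℝ Ψ (x : E4) ≠ 0) :
    ∀ x : 𝔻⁴, c ≤ (fun y : 𝔻⁴ => Ψ y) x → mfderiv (𝓡∂ 4) 𝓘(ℝ, ℝ) (fun y : 𝔻⁴ => Ψ y) x ≠ 0 := by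
  intro x hx h0
  apply hreg x hx
  ext u
  have h1 := mfderiv_comp_coe_ball_apply (hΨ.differentiable (by simp)) x ((closedBallCoeDeriv x).symm u)
  rw [h0, ContinuousLinearEquiv.apply_symm_apply] at h1
  exact h1.symm

/-- **Cieliebak–Eliashberg, Ch. 2 / Grauert: a compact regular strongly `J₀`-convex domain
`{Ψ ≤ c}` of the ball `B⁴ ⊂ ℂ²` is a Stein domain.**  Hypotheses: `Ψ` smooth on `ℝ⁴`; the points
of the closed ball with `Ψ ≤ c` lie in the open ball; `dΨ ≠ 0` at the points of the ball with
`Ψ ≥ c`; the level `{Ψ = c}` meets the ball; the flat Levi form of `Ψ` for `J₀` is positive at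
the points of the ball with `Ψ ≤ c`.  Conclusion: `{x ∈ B⁴ : Ψ x ≤ c}`, with the
manifold-with-boundary structure of a regular sublevel set (`SteinStructure.sublevelOfAtlas`)
and the restrictions of `(J₀, Ψ)` (`SteinStructure.sublevelOf` of the standard structure of
`B⁴`), is a Stein domain. [cite: CieliebakEliashberg2012, Def. 1.1 ff.] -/
theorem isSteinDomain_ballSublevel (hΨ : ContDiff ℝ ∞ Ψ) {c : ℝ}
    (hin : ∀ x : 𝔻⁴, Ψ x ≤ c → ‖(x : E4)‖ < 1)
    (hreg : ∀ x : 𝔻⁴, c ≤ Ψ x → fderiv ℝ Ψ (x : E4) ≠ 0)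
    (hconv : ∀ x : 𝔻⁴, Ψ x ≤ c → ∀ u : E4, u ≠ 0 →
      0 < fderiv ℝ (fderiv ℝ Ψ) (x : E4) u u +
        fderiv ℝ (fderiv ℝ Ψ) (x : E4) (stdComplexStructure u) (stdComplexStructure u))
    (hne : ∃ x : 𝔻⁴, Ψ x = c) :
    letI := (SteinStructure.sublevelOfAtlas (contMDiff_comp_coe_ball hΨ) c (ball_hint hin)
      (ball_hreg hΨ hreg)).chartedSpace
    haveI := (SteinStructure.sublevelOfAtlas (contMDiff_comp_coe_ball hΨ) c (ball_hint hin)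
      (ball_hreg hΨ hreg)).isManifold
    haveI := compactSpace_sublevelOf (W := 𝔻⁴) (contMDiff_comp_coe_ball hΨ).continuous c
    IsSteinDomain ↥((fun y : 𝔻⁴ => Ψ y) ⁻¹' Iic c) := by
  refine steinStructureClosedBall.isSteinDomain_sublevelOf (contMDiff_comp_coe_ball hΨ) (ball_hint hin)
    (ball_hreg hΨ hreg) (fun x hx v hv => ?_) hne
  rw [steinStructureClosedBall_J, neg_mextDeriv_dComplex_ballJ_comp hΨ x v]
  exact hconv x hx _ fun h0 => hv ((closedBallCoeDeriv x).map_eq_zero_iff.1 h0)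

end Literature.Geometry.Symplectic

end
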